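import Mathlib
import Summits.ValiantsHypothesis.ValiantsHypothesis.Theses.FifoMatching
import Summits.ValiantsHypothesis.ValiantsHypothesis.Theorems.FifoMatchingNNNotVPSupportFnExpHard
import Summits.ValiantsHypothesis.ValiantsHypothesis.Theorems.FifoMatchingNNNotVPStubCertificateToSupportFn
import HarnessLib

/-!
# Route FifoMatching — crux `NNDivisionHard` (stmt-ValiantsHypothesis-21181):
# cofactors with ONE monomial of polylog support are not even SUB-EXPONENTIAL certificates

Objects `σ` / `NN` / `SuppFn` / `freeVars` = the vocabulary of line `division_split` of the sibling
crux `NNNotVP` (`Theorems/FifoMatchingNNNotVPDivisionSplitDefs.lean`; `NN n` is definitionally the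
crux's inline nest-free matching polynomial over `ℝ≥0`).

The crux asks `L₊(NN_n · h) + L₊(h) > 2^((log₂ n + c)^c)` eventually, for every nonzero cofactor
`h ∈ ℝ≥0[x]`.  The landed small-support tier (B1 ∘ A of line `division_split`, quasi-polynomial
rate) says this for every `h` having SOME monomial `x^m` with `|supp m| ≤ (log₂ n + k)^k` (any
degree, any other monomials).  With stub A now at EXPONENTIAL rate (`supportFnExpHard`, ✓) the same
two-line argument gives the tier at exponential rate, uncharged (`L₊(h)` not needed):

* ★ `smallSupportCofactor_expHard` — for every `k` there are `r, n₀` with: for all `n ≥ n₀` and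
  every `h` with a monomial of support `≤ (log₂ n + k)^k`, `n ≤ (log₂ L₊(NN_n · h))^r`, i.e.
  `L₊(NN_n · h) ≥ 2^{n^{1/r}}`;
* `constantTerm_cofactor_expHard` — in particular for every `h` with `h(0) ≠ 0` (so for `h = 1`:
  `L₊(NN_n) ≥ 2^{n^{1/r}}`, cf. the tree's `NNMonotoneExpBound` at `2^{n^{1/6}}` by the spread-measure
  method — here via CLIQUE-hardness of shuffle-square recognition);
* `smallSupportCofactor_qpHard_crux` — the crux's own inequality (its verbatim inline `NN_n`, with the
  `+ L₊(h)` term) for this cofactor class, for the census.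

Complementary to the landed degree tier `NNExpDegreeCofactorHard` (✓, cofactors of total degree
`≤ 2^{n^{1/8}}`): the present class contains cofactors of arbitrary degree.  Honest framing: one
cofactor class at a sharper rate; the crux (all `h`), HY21 §6 Problem 2 and `VP ≠ VNP` stay OPEN.
No definitions, no named facts.
-/

noncomputable section

-- Sub = Summit single-conjunct layout: the duplicated namespace component is mandated by the tree.
set_option linter.dupNamespace false

namespace Summit.ValiantsHypothesis.ValiantsHypothesis.Theorems.FifoMatching.NNNotVP.DivisionSplit

open MvPolynomial Finset Literature.Computability.AlgebraicComplexity
open scoped NNReal BigOperators Classical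

/-- ★ **Cofactors with a monomial of polylog support are not sub-exponential certificates.**  For
every `k` there are `r, n₀` such that for all `n ≥ n₀` and every `h ∈ ℝ≥0[x]` having a monomial `x^m`
with `|supp m| ≤ (log₂ n + k)^k`: `n ≤ (log₂ L₊(NN_n · h))^r`.  (B1 `stub_certificateToSupportFn`:
freeing `supp m` in `NN_n · h` gives a polynomial with the support function of `NN_n|_{supp m := 1}`
and no larger `L₊`; stub A at exponential rate `supportFnExpHard`.) [folklore] -/
theorem smallSupportCofactor_expHard :
    ∀ k : ℕ, ∃ r n₀ : ℕ, ∀ n ≥ n₀, ∀ h : MvPolynomial (σ n) ℝ≥0,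
      (∃ m ∈ h.support, m.support.card ≤ (Nat.log 2 n + k) ^ k) →
        n ≤ (Nat.log 2 (complexity (NN n * h))) ^ r := by
  intro k
  obtain ⟨r, n₀, hA⟩ := supportFnExpHard k
  refine ⟨r, n₀, fun n hn h ⟨m, hm, hcard⟩ => ?_⟩
  obtain ⟨g, hg, hgc⟩ := stub_certificateToSupportFn n h m hm
  exact (hA n hn m.support hcard g hg).trans (Nat.pow_le_pow_left (Nat.log_mono_right hgc) r)

/-- **Cofactors with a nonzero constant term are not sub-exponential certificates** (the monomial
`x^0` has empty support); with `h = 1`: `n ≤ (log₂ L₊(NN_n))^r` eventually. [folklore] -/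
theorem constantTerm_cofactor_expHard :
    ∃ r n₀ : ℕ, ∀ n ≥ n₀, ∀ h : MvPolynomial (σ n) ℝ≥0, coeff 0 h ≠ 0 →
      n ≤ (Nat.log 2 (complexity (NN n * h))) ^ r := by
  obtain ⟨r, n₀, h0⟩ := smallSupportCofactor_expHard 0
  refine ⟨r, n₀, fun n hn h hh => h0 n hn h ⟨0, ?_, by simp⟩⟩
  exact MvPolynomial.mem_support_iff.2 hh

/-- `NN_n` itself needs monotone circuits of size `2^{n^{Ω(1)}}`, in the integer form
`n ≤ (log₂ L₊(NN_n))^r` eventually (`h = 1`). [folklore] -/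
theorem nn_complexity_expHard :
    ∃ r n₀ : ℕ, ∀ n ≥ n₀, n ≤ (Nat.log 2 (complexity (NN n))) ^ r := by
  obtain ⟨r, n₀, h⟩ := constantTerm_cofactor_expHard
  refine ⟨r, n₀, fun n hn => ?_⟩
  have := h n hn 1 (by rw [MvPolynomial.coeff_one, if_pos rfl]; exact one_ne_zero)
  simpa only [mul_one] using this

/-- **The crux's inequality for this class** (verbatim inline `NN_n` of stmt-21181, `+ L₊(h)` term
included): for all `k, c`, eventually every `h` with a monomial of support `≤ (log₂ n + k)^k` has
`2^((log₂ n + c)^c) < L₊(NN_n · h) + L₊(h)` — the quasi-polynomial shadow of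
`smallSupportCofactor_expHard` (an exponential bound is eventually above every quasi-polynomial).
[folklore] -/
theorem smallSupportCofactor_qpHard_crux :
    ∀ k c : ℕ, ∃ n₀ : ℕ, ∀ n ≥ n₀, ∀ h : MvPolynomial (Fin (2 * n) × Fin (2 * n)) NNReal,
      (∃ m ∈ h.support, m.support.card ≤ (Nat.log 2 n + k) ^ k) →
        2 ^ ((Nat.log 2 n + c) ^ c) < Literature.Computability.AlgebraicComplexity.complexity ((∑ M : Fin (2 * n) → Fin (2 * n), if ((∀ i, M (M i) = i) ∧ (∀ i, M i ≠ i) ∧ ∀ i j, i < j → j < M j → M j < M i → False) then ∏ i : Fin (2 * n), (if i < M i then MvPolynomial.X (i, M i) else 1) else (0 : MvPolynomial (Fin (2 * n) × Fin (2 * n)) NNReal)) * h) + Literature.Computability.AlgebraicComplexity.complexity h := by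
  intro k c
  obtain ⟨r, n₀, hr⟩ := smallSupportCofactor_expHard k
  obtain ⟨n₁, hn₁⟩ := eventually_polylog_lt c (c * r)
  refine ⟨max n₀ n₁, fun n hn h hm => ?_⟩
  have hn0 : n₀ ≤ n := le_trans (le_max_left _ _) hn
  have hn1 : n₁ ≤ n := le_trans (le_max_right _ _) hn
  -- the route's inline `NN_n` is definitionally the line's `NN n`
  show 2 ^ ((Nat.log 2 n + c) ^ c) < complexity (NN n * h) + complexity h
  have hexp : n ≤ (Nat.log 2 (complexity (NN n * h))) ^ r := hr n hn0 h hm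
  by_contra hle
  push Not at hle
  have hlog : Nat.log 2 (complexity (NN n * h)) ≤ (Nat.log 2 n + c) ^ c :=
    calc Nat.log 2 (complexity (NN n * h)) ≤ Nat.log 2 (2 ^ ((Nat.log 2 n + c) ^ c)) :=
          Nat.log_mono_right (le_trans (Nat.le_add_right _ _) hle)
      _ = (Nat.log 2 n + c) ^ c := Nat.log_pow (by norm_num) _
  have h1 : n ≤ (2 * Nat.log 2 n + c) ^ (c * r) :=
    calc n ≤ (Nat.log 2 (complexity (NN n * h))) ^ r := hexp
      _ ≤ ((Nat.log 2 n + c) ^ c) ^ r := Nat.pow_le_pow_left hlog r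
      _ = (Nat.log 2 n + c) ^ (c * r) := by rw [← pow_mul]
      _ ≤ (2 * Nat.log 2 n + c) ^ (c * r) := Nat.pow_le_pow_left (by omega) _
  exact absurd (hn₁ n hn1) (not_lt.2 h1)

end Summit.ValiantsHypothesis.ValiantsHypothesis.Theorems.FifoMatching.NNNotVP.DivisionSplit

end
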